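import Summits.CriticalPhenomena.PercolationContinuityZ3.Theorems.PercNearOneGluingNoHeavyQuantGluedPairMix
import Summits.CriticalPhenomena.PercolationContinuityZ3.Theorems.PercNearOneGluingNoHeavyQuantJointBlobHull
import HarnessLib

/-!
# QUANT lane R8, T-DEC: the glued pair `R^a[q](R^b[s])` lies in the blob hull `LawDec.InBlobHull` under slack or a light root
# (the `InBlobHull` wrappers of `…QuantGluedPairMix`)

builds on p205010 (kernel theorem, internal audit signed; external expert review pending)

Support file (`--supports stmt-CriticalPhenomena-4575`), QUANT lane lead seat prim-quant-lead (gen 46); two corollaries of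
`gluedPair_mix_of_slack` / `gluedPair_mix_of_le` (✓ `…QuantGluedPairMix`) through typer g40's API (`inBlobHull_blobLaw`, `InBlobHull.mix`,
✓ p407886 `…QuantJointBlobHull`).  Theorems only, standard axioms, no sorries.  READY but UNCHECKED at writing time (the olean of
`…QuantJointBlobHull` was not yet built on the check farm); file it when `lean check` answers rc 0.
[this work].  The gluing rows served [cite: KozmaNitzan2024, Conjecture 3 (p. 15)]; product measure [cite: Grimmett1999, §1.3 p. 10].
-/

noncomputable section

open scoped BigOperators

namespace Summit.CriticalPhenomena.PercolationContinuityZ3.Theorems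
namespace Quant
namespace LawDec

open Finset

/-- the point mass `δ_K` -/
local notation3 "δ[" K "]" => (fun k : ℕ => if k = (K : ℕ) then (1 : ℝ) else 0)

/-- **SLACK ⟹ IN THE BLOB HULL**: for `a, b ≥ 1`, `0 < q < 1`, `0 ≤ s ≤ 1` and `a(1−q) ≤ b(qs − x)`, the glued pair `R^a[q](R^b[s])` lies in
`K_x(q(a+bs))` with top `a + b`. [this work] -/
theorem inBlobHull_gluedPair_of_slack (x q s : ℝ) (a b : ℕ) (ha : 1 ≤ a) (hb : 1 ≤ b) (hq0 : 0 < q) (hq1 : q < 1)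
    (hs0 : 0 ≤ s) (hs1 : s ≤ 1) (hslack : (a : ℝ) * (1 - q) ≤ (b : ℝ) * (q * s - x)) :
    InBlobHull x (q * ((a : ℝ) + (b : ℝ) * s)) (a + b) (gate (slice δ[a] b s) q) := by
  obtain ⟨⟨hw0, hw1⟩, ⟨hg₁x, hg₁1⟩, ⟨hg₃x, hg₃1⟩, e₁, e₂, hmix⟩ := gluedPair_mix_of_slack x q s a b ha hb hq0 hq1 hs0 hs1 hslack
  have hx1 : x ≤ 1 := hg₁x.trans hg₁1
  have m₁ := inBlobHull_blobLaw x [(a + b, q * ((a : ℝ) + b * s) / ((a : ℝ) + b))]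
    (fun p hp => by simp only [List.mem_singleton] at hp; subst hp; exact ⟨hg₁x, hg₁1⟩) (M := a + b) (by simp [blobTop])
  rw [e₁] at m₁
  have m₂ := inBlobHull_blobLaw x [(a, 1), (b, (q * ((a : ℝ) + b * s) - a) / (b : ℝ))]
    (fun p hp => by
      simp only [List.mem_cons, List.not_mem_nil, or_false] at hp
      rcases hp with hp | hp <;> subst hp
      · exact ⟨hx1, le_rfl⟩
      · exact ⟨hg₃x, hg₃1⟩) (M := a + b) (by simp [blobTop]; omega)
  rw [e₂] at m₂
  have key := InBlobHull.mix m₁ m₂ hw0 hw1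
  have e : gate (slice δ[a] b s) q = fun h =>
      (1 - q) * ((a : ℝ) + b) / ((a : ℝ) + b - q * ((a : ℝ) + b * s)) * blobLaw [(a + b, q * ((a : ℝ) + b * s) / ((a : ℝ) + b))] h
        + (1 - (1 - q) * ((a : ℝ) + b) / ((a : ℝ) + b - q * ((a : ℝ) + b * s)))
          * blobLaw [(a, 1), (b, (q * ((a : ℝ) + b * s) - a) / (b : ℝ))] h := funext hmix
  rw [e]; exact key

/-- **LIGHT ROOT ⟹ IN THE BLOB HULL**: for `a, b ≥ 1`, `0 < x ≤ qs`, `0 < q`, `0 ≤ s ≤ 1` and `q(a + bs) ≤ a`, the glued pair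
`R^a[q](R^b[s])` lies in `K_x(q(a+bs))` with top `a + b`. [this work] -/
theorem inBlobHull_gluedPair_of_le (x q s : ℝ) (a b : ℕ) (ha : 1 ≤ a) (hb : 1 ≤ b) (hx0 : 0 < x) (hxs : x ≤ q * s) (hq0 : 0 < q)
    (hs0 : 0 ≤ s) (hs1 : s ≤ 1) (hle : q * ((a : ℝ) + (b : ℝ) * s) ≤ a) :
    InBlobHull x (q * ((a : ℝ) + (b : ℝ) * s)) (a + b) (gate (slice δ[a] b s) q) := by
  obtain ⟨⟨hw0, hw1⟩, ⟨hg₁x, hg₁1⟩, ⟨hg₂x, hg₂1⟩, e₁, e₂, hmix⟩ := gluedPair_mix_of_le x q s a b ha hb hx0 hxs hq0 hs0 hs1 hle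
  have m₁ := inBlobHull_blobLaw x [(a + b, q * ((a : ℝ) + b * s) / ((a : ℝ) + b))]
    (fun p hp => by simp only [List.mem_singleton] at hp; subst hp; exact ⟨hg₁x, hg₁1⟩) (M := a + b) (by simp [blobTop])
  rw [e₁] at m₁
  have m₂ := inBlobHull_blobLaw x [(a, q * ((a : ℝ) + b * s) / (a : ℝ))]
    (fun p hp => by simp only [List.mem_singleton] at hp; subst hp; exact ⟨hg₂x, hg₂1⟩) (M := a + b) (by simp [blobTop])
  rw [e₂] at m₂
  have key := InBlobHull.mix m₁ m₂ hw0 hw1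
  have e : gate (slice δ[a] b s) q = fun h =>
      s * ((a : ℝ) + b) / ((a : ℝ) + b * s) * blobLaw [(a + b, q * ((a : ℝ) + b * s) / ((a : ℝ) + b))] h
        + (1 - s * ((a : ℝ) + b) / ((a : ℝ) + b * s)) * blobLaw [(a, q * ((a : ℝ) + b * s) / (a : ℝ))] h := funext hmix
  rw [e]; exact key

end LawDec
end Quant
end Summit.CriticalPhenomena.PercolationContinuityZ3.Theorems
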